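import Summits.CriticalPhenomena.SAWScalingLimit.Theorems.SAWLoopFugacityFlowIsingBoundaryRatioForgettingDefs
import HarnessLib

/-!
# Definitions for the rough half-annulus RSW stub of the line `fk-anchor-transfer`
(crux `SAWLoopFugacityFlow.IsingBoundaryRatio`, stmt-CriticalPhenomena-10650)

A small definitions module next to `…IsingBoundaryRatioForgettingDefs.lean` (which it imports and does NOT
modify), naming the objects through which the registered stub `stub_roughHalfAnnulusRSW`
(= `RoughHalfAnnulusRSW`) is reduced in `…IsingBoundaryRatioRoughHalfAnnulusRSW.lean`:

* `annEdgeFinset H Ann` — the edges of `H` touching the annulus, as a finset (its coercion is the set `U` of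
  `RoughHalfAnnulusRSW`, `coe_annEdgeFinset`);
* `AnnLink H In Ann` — some walk of `H` joins the inside `In` to the complement of `In ∪ Ann` (a deterministic
  guard: without it nothing is to be separated); `AnnPathSep H In Ann ω` — the PATH form of the open
  separation event (an `ω`-open walk inside `Ann` whose support meets every walk from `In` to the complement
  of `In ∪ Ann`; it implies `AnnSep` with `S` = the support, and is what the domain-Markov step of the heart
  consumes: the separator is wired along its own open edges); `AnnPathSepG` — its guarded form
  `AnnLink → AnnPathSep` (the unguarded path form is FALSE as a lower-bound target in the cylinder form
  below: for a finite volume with `Ann = ∅`, e.g. `Λ = ∅` or `Λ` far from `a`, `AnnPathSep` is empty while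
  the cylinder `ξ = ∅` has probability one);
* `RoughHalfAnnulusRSWOf Sep` — the registered conditional-cylinder statement with the separation event
  `AnnSep` replaced by a parameter `Sep` (`RoughHalfAnnulusRSWOf AnnSep ↔ RoughHalfAnnulusRSW` is `Iff.rfl`,
  `roughHalfAnnulusRSWOf_annSep_iff`), and `RoughHalfAnnulusRSWMeshOf Sep` — its form for the MESH graph
  `Ω_δ` with EXTREMAL boundary conditions (free local measure of the graph `⟨U⟩` of the edges touching the
  annulus for `Sep`, all vertices off the annulus wired together for `AnnCross`; no far graph, no `ξ`, no
  cylinder), the residual target of the reduction;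
* the instances are used APPLIED (`RoughHalfAnnulusRSWMeshOf AnnSep`, `RoughHalfAnnulusRSWOf AnnPathSepG`,
  `RoughHalfAnnulusRSWMeshOf AnnPathSepG`): no parameterless `def … : Prop` is introduced here.

Every proposition named here is a TARGET of the line (to be proved from Chelkak–Duminil-Copin–Hongler 2016
Thm 1.1 + Chelkak's toolbox §6–7 + the planar topology of `Ω_δ`), not a cited fact; nothing is asserted.
-/

noncomputable section

open scoped Classical Topology
open Filter Set Metric SimpleGraph
open Literature.Probability.LatticeModels Literature.Probability.RandomPlanarGeometry
open Literature.Probability.Percolation (BondConfig)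
open UpperHalfPlane (upperHalfPlaneSet)

namespace Summit.CriticalPhenomena.SAWScalingLimit.Theorems.IsingBoundaryRatio

section Events

variable {Λ : Finset (Site 2)}

/-- The edges of `H` touching the annulus `Ann`, as a finset — the set `U` of `RoughHalfAnnulusRSW` is
its coercion (`coe_annEdgeFinset`). [folklore] -/
def annEdgeFinset (H : SimpleGraph Λ) (Ann : Set Λ) : Finset (Sym2 Λ) :=
  Finset.univ.filter fun e => e ∈ H.edgeSet ∧ ∃ v ∈ Ann, v ∈ e

/-- Membership in `annEdgeFinset`, unfolded. [folklore] -/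
@[simp] theorem mem_annEdgeFinset {H : SimpleGraph Λ} {Ann : Set Λ} {e : Sym2 Λ} :
    e ∈ annEdgeFinset H Ann ↔ e ∈ H.edgeSet ∧ ∃ v ∈ Ann, v ∈ e := by
  simp [annEdgeFinset]

/-- The coercion of `annEdgeFinset` is the set `U` of `RoughHalfAnnulusRSW`. [folklore] -/
theorem coe_annEdgeFinset (H : SimpleGraph Λ) (Ann : Set Λ) :
    (↑(annEdgeFinset H Ann) : Set (Sym2 Λ)) = {e | e ∈ H.edgeSet ∧ ∃ v ∈ Ann, v ∈ e} :=
  Set.ext fun e => by simp [mem_annEdgeFinset]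

/-- **Link**: some walk of `H` joins the inside `In` of the annulus to the complement of `In ∪ Ann`
(deterministic guard of the path separation event). [folklore] -/
def AnnLink (H : SimpleGraph Λ) (In Ann : Set Λ) : Prop :=
  ∃ (a b : Λ) (_ : H.Walk a b), a ∈ In ∧ b ∉ In ∪ Ann

/-- **Open path separation of the half-annulus** (PATH form of `AnnSep`): an `ω`-open walk of `H` inside
the annulus whose support meets every walk of `H` from the inside `In` to the complement of `In ∪ Ann`.
[folklore] -/
def AnnPathSep (H : SimpleGraph Λ) (In Ann : Set Λ) (ω : BondConfig Λ) : Prop :=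
  ∃ (u v : Λ) (p : H.Walk u v), (∀ z ∈ p.support, z ∈ Ann) ∧ (∀ e ∈ p.edges, e ∈ ω) ∧
    ∀ (a b : Λ), a ∈ In → b ∉ In ∪ Ann → ∀ q : H.Walk a b, ∃ z ∈ q.support, z ∈ p.support

/-- **Guarded open path separation**: if some walk joins `In` to the complement of `In ∪ Ann`, then
`AnnPathSep` (vacuously true for finite volumes that do not see the annulus). [folklore] -/
def AnnPathSepG (H : SimpleGraph Λ) (In Ann : Set Λ) (ω : BondConfig Λ) : Prop :=
  AnnLink H In Ann → AnnPathSep H In Ann ω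

end Events

/-- **Rough half-annulus RSW, conditional-cylinder form, with separation event `Sep`**: literally the
registered `RoughHalfAnnulusRSW` with `AnnSep` replaced by the parameter `Sep` (so that
`RoughHalfAnnulusRSWOf AnnSep` is `RoughHalfAnnulusRSW` by `Iff.rfl`). [folklore] -/
def RoughHalfAnnulusRSWOf
    (Sep : ∀ {Λ : Finset (Site 2)}, SimpleGraph Λ → Set Λ → Set Λ → BondConfig Λ → Prop) : Prop :=
  ∀ (D : DobrushinDomain) (φ : ConformalEquiv upperHalfPlaneSet D.carrier),
    D.IsChordalUniformizing φ → ∀ (M : ℝ), 1 < M → ∃ c : ℝ, 0 < c ∧ ∀ (ε : ℝ), 0 < ε →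
      ∃ ρ₀ : ℝ, 0 < ρ₀ ∧ ∀ (ρ : ℝ), 0 < ρ → ρ < ρ₀ → ∀ᶠ δ in 𝓝[>] (0 : ℝ),
        ∀ (G : SimpleGraph (Site 2)) [G.LocallyFinite] (Λ : Finset (Site 2)),
          LocalAgreement D.carrier (D.pt 0) ε δ G Λ →
          ∀ (ξ : Set (Sym2 Λ)),
            let H : SimpleGraph Λ := G.comap Subtype.val
            let In : Set Λ := annIn D φ ε δ ρ Λ
            let Ann : Set Λ := annBody D φ M ε δ ρ Λ
            let U : Set (Sym2 Λ) := {e | e ∈ H.edgeSet ∧ ∃ v ∈ Ann, v ∈ e}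
            let P := rcMeasure H (1 - Real.exp (-2 * criticalBetaTwo)) 2 ∅
            c * P.real {ω | ω ∩ Uᶜ = ξ} ≤ P.real ({ω | Sep H In Ann ω} ∩ {ω | ω ∩ Uᶜ = ξ}) ∧
            P.real ({ω | AnnCross H In Ann ω} ∩ {ω | ω ∩ Uᶜ = ξ}) ≤
              (1 - c) * P.real {ω | ω ∩ Uᶜ = ξ}

/-- The registered stub's statement is the instance `Sep = AnnSep` (definitional). [folklore] -/
theorem roughHalfAnnulusRSWOf_annSep_iff : RoughHalfAnnulusRSWOf AnnSep ↔ RoughHalfAnnulusRSW := Iff.rfl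

/-- **Rough half-annulus RSW for the MESH graph with EXTREMAL boundary conditions, separation event `Sep`**
(the residual TARGET of the reduction; printed sources of its eventual proof: Chelkak–Duminil-Copin–Hongler
2016 Thm 1.1 with Remark 2.2, Chelkak's toolbox §6–7, the planar topology of `Ω_δ ⊆ δℤ²` near the rough
arcs). For the chordal chart `φ` and `M > 1` there is `c > 0` such that for every `ε` there is `ρ₀ > 0`
with: for every `ρ < ρ₀`, all small `δ`, and every finite set of sites `Λ` containing the `Ω_δ`-neighbours
of its sites in `B(a, ε)` (`LocalAgreement` for `Ω_δ` itself), writing `H = Ω_δ.comap val` on `↥Λ` and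
`U = annEdgeFinset H Ann`: the FREE critical FK-Ising measure of the local graph `⟨U⟩` (vertex type `↥Λ`;
vertices off `U` are isolated and irrelevant) gives `Sep` probability `≥ c`, and the measure of `⟨U⟩` with
ALL vertices off `Ann` WIRED into one class (the maximal boundary condition on the two rims) gives the open
radial crossing `AnnCross` probability `≤ 1 - c`. [folklore] -/
def RoughHalfAnnulusRSWMeshOf
    (Sep : ∀ {Λ : Finset (Site 2)}, SimpleGraph Λ → Set Λ → Set Λ → BondConfig Λ → Prop) : Prop :=
  ∀ (D : DobrushinDomain) (φ : ConformalEquiv upperHalfPlaneSet D.carrier),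
    D.IsChordalUniformizing φ → ∀ (M : ℝ), 1 < M → ∃ c : ℝ, 0 < c ∧ ∀ (ε : ℝ), 0 < ε →
      ∃ ρ₀ : ℝ, 0 < ρ₀ ∧ ∀ (ρ : ℝ), 0 < ρ → ρ < ρ₀ → ∀ᶠ δ in 𝓝[>] (0 : ℝ),
        ∀ (Λ : Finset (Site 2)),
          LocalAgreement D.carrier (D.pt 0) ε δ (discreteDomainGraph D.carrier δ) Λ →
            let H : SimpleGraph Λ := (discreteDomainGraph D.carrier δ).comap Subtype.val
            let In : Set Λ := annIn D φ ε δ ρ Λ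
            let Ann : Set Λ := annBody D φ M ε δ ρ Λ
            c ≤ (rcMeasure (fromEdgeSet (↑(annEdgeFinset H Ann) : Set (Sym2 Λ)))
                (1 - Real.exp (-2 * criticalBetaTwo)) 2 ∅).real {ω | Sep H In Ann ω} ∧
            (rcMeasure (fromEdgeSet (↑(annEdgeFinset H Ann) : Set (Sym2 Λ)))
                (1 - Real.exp (-2 * criticalBetaTwo)) 2 Annᶜ).real {ω | AnnCross H In Ann ω} ≤ 1 - c

end Summit.CriticalPhenomena.SAWScalingLimit.Theorems.IsingBoundaryRatio

end
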